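import Summits.HodgeConjecture.HodgeConjecture.Theorems.R90S9HcoeffMemAtUnitsOfRecordPartner    -- ★ p863200 (this seat, (CMP-cov)): the row-34 token of ED. 4; cone: ★ p862993 (units of record, `xiTruncOfRecordSCD`), ★ p862897 §1, ★ p862535, ★ letter #79, ★ letter D
import HarnessLib

/-!
# R90-TF · S9 «InnerForm-13.3.6 (c)» — (LF-cut, ED. 5 groundwork) THE ROW-34 TOKEN WITH THE LEVEL IDENTITY ASKED AT A-PACKETS ONLY: `hcoeffMem_binder_gammaSph_recordSCD_atUnitsOfRecord_partnerA'`
# («(14.6.3) at `Π(ξ)` needs a level only when some discrete `π′` has `t(π′) = t(Π(ξ))`» — Rogawski 1990, §14.6 p. 242 l. 10–22, Thm. 14.6.4 proof pp. 244–245)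

Cell `hodgecm-mathlib`, crux H413 (`stmt-HodgeConjecture-24833`, lane `--supports … --as helper`), route of record `HCCMUnconditional` (no route verbs; count-neutral).
Programme R90-TF (HUMAN RULING «R90-TF SLAB — MAX PUSH»; brief `director/R90-BRIEF.v2.md` 1f40d54518340a35), section S9 = InnerForm-13.3.6 (c) (base `R90-IF`); seat
R90-IF-p03 (g3), (CMP) lineage.  DEALT BY NAME: R90-IF-plan (g2) 2026-09-04T23:38:08Z (CMP-cov) «decide the `hcoverCMP` question for p06's (δ6s) … (ⅱ) post the EXACT re-cut binder»;
my verdict (ⅱ) 23:4xZ (R90 bus): the ∀-packet cover `hcoverCMP` of ★ (δ6d) `definiteAeRigidity_payLine_cmp` :317 is NOT S9-payable (R90-IF-audit1 flag F-coverCMP: a packet of `G`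
WITHOUT an e.v.p.-partner on `G′` need not be graded at any level), and it entered only because ★ (CMP-L)'s `h63` discharge went through ★ `eq1462HasSum_of_levels'`, whose cover
is asked at EVERY packet.  THE FIX IS ON THE (CMP) SIDE: the (CMP) binder's conclusion `∀ π′, t(π′) = t(P) → m(π′) ≠ 0 → π′ ∈ Π′(ξ)` is VACUOUS at a partnerless `P`, so the
(14.6.3)-`HasSum` (`h63`) is needed only at the `P` of a GIVEN partner `π′` — and there ★ p863134 `hcover_gammaSph_of_partner` (R90-IF-p07) ∕ (δ6d)'s `hcover𝓣` DO supply a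
level.  ED. 5 GROUNDWORK (R90-IF-plan (g2) RULING (LF-cut) 2026-09-05T00:21:03Z: «the strike of `sock_S9_liftsFinite_cm` is BOOKED FOR ED. 5 as a pure swap; p03: GO on (1)+(2) now»): THIS FILE = (2), the sibling of ★ p863200 in which the `tsum` level identities are asked AT A-PACKETS ONLY (`hlevT ↦ hlevTA`), so that their payer needs `|Π̂(P)| < ∞` only at `P = Π(ξ)` — where `lifts P = {ξ}` (`sock_S9_lifts1_cm`) gives it — and the ∀-packet finiteness socket disappears.  (The text below is ★ p863200's with that one change.)  THIS FILE: (1) `hasSum_eq1463_at_of_levelA` — over the abstract carpet `Γ`, (14.6.3) at ONE A-packet `P = Π(ξ)` as the indicator `HasSum`, from ONE graded pair `(l, e)`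
for `(f′, P)` plus the level tuple `hsum𝓕 hlevT hgerm hrig` and the packet laws at `P` (★ p862413 §3's proof LOCALISED at `P`, then ★ p862382 §3's three rewrites); (2)
**`hcoeffMem_binder_gammaSph_recordSCD_atUnitsOfRecord_partnerA'`** — ★ p862993 `…_atUnitsOfRecord'` with its cover binder RE-CUT to the PARTNER-GUARDED
**`hcoverP : ∀ f′ f P, ‹𝓕₀-guard f′› → (∃ π′, m′ π′ ≠ 0 ∧ evpRep π′.1 (X.finOfG P)) → Transfer f′ f → ∃ l e, 𝓕 l f′ ∧ tP l P = some e`** (everything else BYTEWISE; conclusion = the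
(δ1)∕(δ5)∕(δ6·) `hcoeffMem` binder type token for token) — proof: `intro … π′ hevp hm`, then ★ p862535 `hcoeffMem_gammaSph_recordSCD` at `(P, ξ)` with all its letters discharged as in ★
`…_atUnitsOfRecord'` and `h63 :=` (1) at the cover of `(φ, P)` for the partner `⟨π′, hm, hevp⟩`.  At (δ6s): `hcoverP := fun f′ f P hφ hpart _ => ‹hcover𝓣 f′ hφ P hpart l₀, lifted to
the deep-level subtype›` — the SAME `hcover𝓣` that feeds `hmn`; NO `hcoverCMP` binder.
THEOREMS ONLY, PURE COMPOSITION: no `def`, no instance, no notation, no named fact, no `sorry`; imports ★ `Theorems` only; namespace `Summit.HodgeConjecture.HodgeConjecture.R90.S9`.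
HONEST LABEL: HC_CM is proved only modulo the 7 printed citations (2 remaining named inputs: hLiu418 = stmt-HodgeConjecture-24832, h413 = stmt-HodgeConjecture-24833) —
until rung 0 closes.  A binder re-cut; closes no leaf.  Residual (CMP) letters unchanged: `htrX` (`:= htrX_cm`), F1b ∕ «ARCH», `p`+`hp`, `a₀ ha₀` (S2), `hR₁ hR₂` (S3∕S7, at
`T₀ := xiTruncOfRecordSCD`), `hex` (★ p862997 in-file), the level tuple (`hcoverP` now = `hcover𝓣`, shared with (MN)) + `hlifts hn hnH`.

## What is here (sorry-free, axioms ⊆ {propext, Classical.choice, Quot.sound})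
* §1 `hasSum_eq1463_at_of_levelA` (abstract carpet).
* §2 **`hcoeffMem_binder_gammaSph_recordSCD_atUnitsOfRecord_partnerA'`** (the ROW-34 token with the partner-guarded cover).

[cite: Rogawski1990, §14.6 p. 242 l. 10–22 and (14.6.2) (chunk p0236 L6–11), (14.6.3) and Thm. 14.6.4 with its proof pp. 244–245 (chunks p0238 L9 – p0239 L4); §13.3 Thm. 13.3.5 p. 202, p. 203; §11.2 Prop. 11.2.1 p. 162; §12.2 (2) pp. 173–174; Prop. 13.8.1 p. 206]
[cite: FlathCorvallis1979, Thm. 3 and Thm. 4] [cite: JacquetShalika1981, Thm. 4.4] [cite: GelbartRogawski1991, Lem. 5.1.2 p. 466] [cite: CartierCorvallis1979, §IV.1 Cor. 4.1]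
-/

set_option autoImplicit false
-- the mandated namespace repeats `HodgeConjecture.HodgeConjecture`, as in every `Theorems/*.lean` of this sub-problem
set_option linter.dupNamespace false

noncomputable section

namespace Summit.HodgeConjecture.HodgeConjecture.R90.S9

open Finset Filter
open Literature.NumberTheory Literature.NumberTheory.Automorphic Literature.NumberTheory.GaloisRepresentations
open NumberField IsDedekindDomain MeasureTheory
open Literature.NumberTheory.Rogawski1990 Literature.NumberTheory.Automorphic.UnitaryGroup
open Literature.NumberTheory.Automorphic.UnitaryGroup.CotangentForms (cmCompactFactor)
open Literature.RepresentationTheory.KonnoKonno2007 Literature.RepresentationTheory.KonnoKonno2007.RealDualPair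
open Literature.RepresentationTheory.KonnoKonno2007.RealDualPair.UForm
open Summit.HodgeConjecture.HodgeConjecture.Cruxes.H413 Summit.HodgeConjecture.HodgeConjecture.Cruxes.H413.F0P3ClassTokenChoice
open Summit.HodgeConjecture.HodgeConjecture.Cruxes.H413.F0P3GlobalPacket Summit.HodgeConjecture.HodgeConjecture.Cruxes.H413.F0P3LocalPacketKit
open Summit.HodgeConjecture.HodgeConjecture.Cruxes.H413.F0P3XiLocalFamilyOfRecord Summit.HodgeConjecture.HodgeConjecture.Cruxes.H413.F0P3XiPacketFamilyOfRecord
open Summit.HodgeConjecture.HodgeConjecture.Cruxes.H413.F0P3XiPacketFamilyOfRecordSCD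
open InnerFormSec146
open scoped Matrix MatrixGroups Classical ComplexOrder

universe u u₁ u₂ u₃ u₄ u₅

/-! ## §1 (14.6.3) at ONE A-packet from ONE graded level (abstract carpet) -/

section Carpet

variable {TG' : Type u₁} {TG : Type u₂} {TH : Type u₃} (Γ : Ch14Sec6.GlobalData.{u} TG' TG TH)
  (Transfer : TG' → TG → Prop) (TransferH : TG' → TH → Prop)

/-- **(14.6.3) AT ONE A-PACKET `P = Π(ξ)` FROM ONE GRADED LEVEL** — the indicator `HasSum` «`Σ_{t(π′)=t(P)} m(π′) Tr π′(f′) = ½ Tr P(f) + ½ Tr ξ(f^H)`» for matching `(f′, f, f^H)`,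
from: a level `l` with `𝓕 l f′` at which `P` is graded (`tP l P = some e`), summability on the test class (`hsum𝓕`), the `tsum` level identity AT THIS `(l, e, f′, P)`
(`hlevP`, (14.6.1) + separation of eigenvalues), the definitional direction `hgerm` and the rigidity pin `hrig` (★ p862413 §3's binders, USED AT THIS `(l, f′, P)` ONLY), and the packet laws at `P`: `n(P) = ½`,
`Π̂(P) ∩ Π(H) = {ξ}` (`lifts P = {ξ}`), `n(ξ) = 1`.  Proof = ★ `eq1462HasSum_of_levels'`'s argument localised at `P` (the germ fibre and the level fibre agree on the support), then the
three rewrites of ★ `hasSum_eq1463_of_hasSum_eq1462`. [cite: Rogawski1990, §14.6 p. 242 l. 10–22 (chunk p0236 L6–11), (14.6.3) p. 244 (chunk p0238 L12–13); §13.3 Thm. 13.3.5 p. 202, p. 203; §11.2 Prop. 11.2.1 p. 162] [cite: JacquetShalika1981, Thm. 4.4] -/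
theorem hasSum_eq1463_at_of_levelA
    {Λ : Type u₄} (𝓕 : Λ → TG' → Prop)
    (hsum𝓕 : ∀ (l : Λ) (f' : TG'), 𝓕 l f' → Summable (fun π' : Γ.Rep' => (Γ.m' π' : ℂ) * Γ.tr' π' f'))
    {E : Λ → Type u₅}
    (tR : ∀ l : Λ, Γ.Rep' → Option (E l)) (tP : ∀ l : Λ, Γ.G.Packet → Option (E l))
    (hgerm : ∀ (l : Λ) (π' : Γ.Rep') (P : Γ.G.Packet) (e : E l), tP l P = some e → tR l π' = some e → Γ.evpRep π' P)
    (hrig : ∀ (l : Λ) (f' : TG'), 𝓕 l f' → ∀ (π' : Γ.Rep') (P : Γ.G.Packet) (e : E l), tP l P = some e →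
      Γ.evpRep π' P → (Γ.m' π' : ℂ) * Γ.tr' π' f' ≠ 0 → tR l π' = some e)
    (P : Γ.G.Packet) (ξ : Γ.G.PacketH) (f' : TG') (f : TG) (fH : TH) {l : Λ} {e : E l}
    (hF : 𝓕 l f') (hP : tP l P = some e)
    -- the `tsum` level identity AT `(l, e)` FOR THIS `(f′, f, f^H, P)` ((14.6.2)_{S′}; payer ★ `eq1462LevelTsum_at_of_thm1461_of_separation'`)
    (hlevP : (∑' π' : tR l ⁻¹' {some e}, (Γ.m' (π' : Γ.Rep') : ℂ) * Γ.tr' π' f') =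
      Γ.G.n P * Γ.G.packetTrace Γ.tr P f + 1 / 2 * Γ.G.endoSum Γ.trH P fH)
    (hn : Γ.G.n P = 1 / 2) (hlifts : Γ.G.lifts P = {ξ}) (hnH : Γ.G.nH ξ = 1) :
    HasSum (fun π' => {π' : Γ.Rep' | Γ.evpRep π' P}.indicator (fun π' => (Γ.m' π' : ℂ) * Γ.tr' π' f') π')
      (1 / 2 * Γ.G.packetTrace Γ.tr P f + 1 / 2 * Γ.trH ξ fH) := by
  let x : Γ.Rep' → ℂ := fun π' => (Γ.m' π' : ℂ) * Γ.tr' π' f'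
  -- the germ fibre and the level fibre agree on the support of `x`
  have hAB : {π' : Γ.Rep' | Γ.evpRep π' P} ∩ Function.support x = tR l ⁻¹' {some e} ∩ Function.support x := by
    ext π'
    simp only [Set.mem_inter_iff, Set.mem_setOf_eq, Set.mem_preimage, Set.mem_singleton_iff, Function.mem_support]
    constructor
    · rintro ⟨hevp, hne⟩
      exact ⟨hrig l f' hF π' P e hP hevp hne, hne⟩
    · rintro ⟨htR, hne⟩
      exact ⟨hgerm l π' P e hP htR, hne⟩
  have hind : {π' : Γ.Rep' | Γ.evpRep π' P}.indicator x = (tR l ⁻¹' {some e}).indicator x := by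
    rw [← Set.indicator_inter_support, hAB, Set.indicator_inter_support]
  -- the level fibre series has the (14.6.2) value
  have hS : Summable x := hsum𝓕 l f' hF
  have h1 : HasSum (x ∘ (↑) : tR l ⁻¹' {some e} → ℂ) (∑' π' : tR l ⁻¹' {some e}, x π') :=
    (hS.subtype (· ∈ tR l ⁻¹' {some e})).hasSum
  rw [hlevP] at h1
  have h62 : HasSum ({π' : Γ.Rep' | Γ.evpRep π' P}.indicator x)
      (Γ.G.n P * Γ.G.packetTrace Γ.tr P f + 1 / 2 * Γ.G.endoSum Γ.trH P fH) := by
    rw [hind]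
    exact hasSum_subtype_iff_indicator.mp h1
  -- (14.6.2) ⟹ (14.6.3) at the A-packet: `n(P) = ½`, `endoSum` over `lifts P = {ξ}`, `n(ξ) = 1`
  rw [hn, GlobalPacketData.endoSum_def, hlifts, finsum_mem_singleton, hnH, one_mul] at h62
  exact h62

end Carpet

section Record

variable (L : Type) [Field L] [NumberField L] [IsCMField L] (ι₀ : L →+* ℂ) (H : Matrix (Fin 3) (Fin 3) L)
  (T : GL (Fin 3) ℂ) (hT : (T : Matrix (Fin 3) (Fin 3) ℂ)ᴴ * H.map ι₀ * (T : Matrix (Fin 3) (Fin 3) ℂ) = Literature.Geometry.ComplexHyperbolic.BallModel.J)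
  (νinf : @Measure (UnitaryGroup.arch (↥(maximalRealSubfield L)) L (IsCMField.complexConj L) 3 H) (borel _))
  (μv : ∀ v : HeightOneSpectrum (𝓞 ↥(maximalRealSubfield L)), @Measure ((cmDatum L 3 H).Local v) (borel _))
  (hdef : ∀ τ' : L →+* ℂ, InfinitePlace.mk τ' ≠ InfinitePlace.mk ι₀ → (H.map τ').PosDef)
  (hν : @Measure.IsHaarMeasure _ _ _ (borel _) νinf)
  (hμ : ∀ v : HeightOneSpectrum (𝓞 ↥(maximalRealSubfield L)), @Measure.IsHaarMeasure _ _ _ (borel _) (μv v))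
  -- the SCD record data (★ `F0P3XiPacketFamilyOfRecordSCD`, token for token)
  (hH : (H.map (cmConjRingHom L))ᵀ = H) (hHd : IsUnit H.det) (μω : HeckeCharacter L) (hμu : μω.IsUnitary)
  [∀ v : HeightOneSpectrum (𝓞 ↥(maximalRealSubfield L)), MeasurableSpace (Gqs L v ⧸ Subgroup.center (Gqs L v))]
  (μZ : ∀ v : HeightOneSpectrum (𝓞 ↥(maximalRealSubfield L)), Measure (Gqs L v ⧸ Subgroup.center (Gqs L v)))
  (keys : ∀ (ξ : OneDimAutRepH L) (v : HeightOneSpectrum (𝓞 ↥(maximalRealSubfield L))),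
    (∀ w : PlacesOver L v, IsCMField.complexConj L • w.1 = w.1) →
      {p : IrrClass (Gqs L v) × IrrClass (Gqs L v) //
        KeysCaseTwoLabels L v (μω.semilocalComponent L v) (torusLocalComponent L (IsCMField.complexConj L) v ξ.η)
          (torusLocalComponent L (IsCMField.complexConj L) v ξ.ψ) p.1 p.2 ∧
        p.1.IsSquareIntegrable (μZ v) ∧ ¬ p.2.IsSquareIntegrable (μZ v)})
  (hSC : ∀ (ξ : OneDimAutRepH L) (v : HeightOneSpectrum (𝓞 ↥(maximalRealSubfield L)))
    (hns : ∀ w : PlacesOver L v, IsCMField.complexConj L • w.1 = w.1)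
    (T : GL (Fin 3) (LocalRing L v)) (a : LocalRing L v) (ha : IsUnit a)
    (h : formCongr (conjLocal L (IsCMField.complexConj L) v) T (H.map (algebraMap L (LocalRing L v))) =
      a • (Matrix.of fun i j : Fin 3 => if i.val + j.val + 1 = 3 then (1 : L) else 0).map (algebraMap L (LocalRing L v)))
    (π2 πn : IrrClass (Gqs L v)),
    KeysCaseTwoLabels L v (μω.semilocalComponent L v) (torusLocalComponent L (IsCMField.complexConj L) v ξ.η)
      (torusLocalComponent L (IsCMField.complexConj L) v ξ.ψ) π2 πn → ¬ πn.IsSquareIntegrable (μZ v) →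
    {πs : IrrClass ((cmDatum L 3 H).Local v) // πs.IsSupercuspidal ∧ πs ≠ IrrClass.comap (cmDatumLocalCongr L v T ha h).symm πn})
  {TG TH : Type}
  (μA : Measure (adelicGroupData (↥(maximalRealSubfield L)) L (IsCMField.complexConj L) 3 H).automorphicQuotient)
  [(adelicGroupData (↥(maximalRealSubfield L)) L (IsCMField.complexConj L) 3 H).IsAutomorphicMeasure μA]
  {H' : Matrix (Fin 3) (Fin 3) L}
  (𝔩 : ∀ v : HeightOneSpectrum (𝓞 ↥(maximalRealSubfield L)), LocalPacketKit L H' v)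


/-! ## §2 The ROW-34 token with the partner-guarded cover -/

include hdef hν hμ in
/-- **(CMP-cov) `hcoeffMem_binder_gammaSph_recordSCD_atUnitsOfRecord_partnerA'` — THE (CMP) BINDER OF FILE B ED. 4's PAY LINE AT THE UNITS OF RECORD, WITH THE LEVEL COVER
PARTNER-GUARDED.**  = ★ p862993 `hcoeffMem_binder_gammaSph_recordSCD_atUnitsOfRecord'` with the binder `hcover` replaced by
`hcoverP : ∀ f′ f P, ‹𝓕₀-guard f′› → (∃ π′, mPrimeSph … π′ ≠ 0 ∧ evpRep … π′.1 (X.finOfG P)) → Transfer f′ f → ∃ l e, 𝓕 l f′ ∧ tP l P = some e` (the guard of ★ p863134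
`hcover_gammaSph_of_partner` ∕ (δ6d)'s `hcover𝓣`, plus the test guard and `Transfer`); every other binder and the CONCLUSION — the (δ1)∕(δ5)∕(δ6·) `hcoeffMem` binder type —
token for token.  Proof: for `P ξ h₁ hS hA hl` and a CONTRIBUTING `π′` (`evpRep π′ P`, `m′ π′ ≠ 0`), ★ p862535 `hcoeffMem_gammaSph_recordSCD` at `(P, ξ)` with the letters discharged
as in ★ `…_atUnitsOfRecord'` (`e_v := 𝟙_{K_v}`, `he1` under `μ_v(K_v) = 1`, `hun hus hne` ★ (CMP-L3) §1, `hexc` ★ letter #79, `T₀ := xiTruncOfRecordSCD`, `hn1 hs0` ★ (CMP-L5)) and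
`h63 :=` §1 at a level covering `(φ, P)` — which `hcoverP` supplies because `π′` is a partner of `P`.
[cite: Rogawski1990, §14.6 p. 242 l. 10–22 (chunk p0236 L6–11), Thm. 14.6.4 with its proof pp. 244–245 (chunks p0238 L9 – p0239 L4); §13.3 Thm. 13.3.5 p. 202, p. 203; §11.2 Prop. 11.2.1 p. 162; §12.2 (1)–(2) pp. 173–174; Prop. 13.8.1 p. 206] [cite: FlathCorvallis1979, Thm. 3 and Thm. 4] [cite: JacquetShalika1981, Thm. 4.4] [cite: GelbartRogawski1991, Lem. 5.1.2 p. 466] -/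
theorem hcoeffMem_binder_gammaSph_recordSCD_atUnitsOfRecord_partnerA'
    (hμω : ∀ x : Literature.NumberTheory.GaloisRepresentations.ideleGroup ↥(maximalRealSubfield L),
      μω (AdeleRing.ideleBaseChange (↥(maximalRealSubfield L)) L x) = quadraticHeckeCharCM L x)
    (hquad : ∀ v : HeightOneSpectrum (𝓞 ↥(maximalRealSubfield L)), (∀ w : PlacesOver L v, IsCMField.complexConj L • w.1 = w.1) →
      IsQuadraticCharExtension (conjLocal L (IsCMField.complexConj L) v) (μω.semilocalComponent L v))
    [∀ v : HeightOneSpectrum (𝓞 ↥(maximalRealSubfield L)), BorelSpace (Gqs L v ⧸ Subgroup.center (Gqs L v))]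
    [∀ v : HeightOneSpectrum (𝓞 ↥(maximalRealSubfield L)), (μZ v).IsHaarMeasure]
    -- NEW: the product-Haar normalisation `μ_v(K_v) = 1` (★ `IsProductHaar` clause; B: `hvol`) — the units are `e_v := 𝟙_{K_v}` (TG-4, ★ `UnrTensor.unit`; = `(Smooth_cm p).1`'s units)
    (hμK1 : ∀ v : HeightOneSpectrum (𝓞 ↥(maximalRealSubfield L)), μv v (cmLocalIntegralLevel L 3 H v : Set ((cmDatum L 3 H).Local v)) = 1)
    (hanis : ∀ x : Fin 3 → L, Literature.AlgebraicGeometry.ShimuraVarieties.hermForm (cmConjRingHom L) H x x = 0 → x = 0)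
    (hF1b : ∀ P₀ Q₀ : DiscreteAutomorphicRep (adelicGroupData (↥(maximalRealSubfield L)) L (IsCMField.complexConj L) 3 H) μA,
      IsKcSpherical L ι₀ H T hT μA P₀ → IsKcSpherical L ι₀ H T hT μA Q₀ →
      P₀.UnitaryEquivOfComponents Q₀ (uFormGroup (Fin 2) (Fin 1)) (cmArchSectionUForm L ι₀ H T hT) (cmCompactFactor L ι₀ H T hT))
    (hARCH : ArchComponentOfDiscrete L ι₀ H T hT μA)
    (X : DatumInputs ((UnitaryGroup.arch (↥(maximalRealSubfield L)) L (IsCMField.complexConj L) 3 H → ℂ) ×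
        (∀ v : HeightOneSpectrum (𝓞 ↥(maximalRealSubfield L)), (cmDatum L 3 H).Local v → ℂ)) TG TH L ι₀ H T hT μA (xiPacketFamilyOfRecordSCD L H hH hHd μω hμu μZ keys hSC) 𝔩)
    (Transfer : (UnitaryGroup.arch (↥(maximalRealSubfield L)) L (IsCMField.complexConj L) 3 H → ℂ) ×
        (∀ v : HeightOneSpectrum (𝓞 ↥(maximalRealSubfield L)), (cmDatum L 3 H).Local v → ℂ) → TG → Prop)
    (TransferH : (UnitaryGroup.arch (↥(maximalRealSubfield L)) L (IsCMField.complexConj L) 3 H → ℂ) ×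
        (∀ v : HeightOneSpectrum (𝓞 ↥(maximalRealSubfield L)), (cmDatum L 3 H).Local v → ℂ) → TH → Prop)
    (htrX : ∀ (π' : RepPrimeSph L ι₀ H T hT μA) (φf : (UnitaryGroup.arch (↥(maximalRealSubfield L)) L (IsCMField.complexConj L) 3 H → ℂ) ×
        (∀ v : HeightOneSpectrum (𝓞 ↥(maximalRealSubfield L)), (cmDatum L 3 H).Local v → ℂ)),
      X.trPrime π' φf = archTr₀ L ι₀ H T hT νinf (tupleOf L ι₀ H T hT μA π').1 φf.1 *
        ∏ᶠ v, (letI : MeasurableSpace ((cmDatum L 3 H).Local v) := borel _;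
          ((tupleOf L ι₀ H T hT μA π').2 v).smoothTrace (μv v) (φf.2 v)))
    -- the per-`(P, ξ)` letters, ∀-closed
    (p : ∀ ξ : X.G.PacketH, X.IsOneDimH ξ → HeightOneSpectrum (𝓞 ↥(maximalRealSubfield L)) → Prop)
    -- NEW: the two-member places are NON-SPLIT (print §12.2 (2): `Π(ξ_v) = {πⁿ, πˢ}` iff `v` does not split in `L/L⁺`; at `p := non-split` this is `fun _ _ _ h => h`)
    (hp : ∀ (ξ : X.G.PacketH) (h₁ : X.IsOneDimH ξ) (v : HeightOneSpectrum (𝓞 ↥(maximalRealSubfield L))), p ξ h₁ v →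
      ∀ w : PlacesOver L v, IsCMField.complexConj L • w.1 = w.1)
    (a₀ : ∀ ξ : X.G.PacketH, X.IsOneDimH ξ → GKIrrClass (uFormGroup (Fin 2) (Fin 1)))
    (ha₀ : ∀ (ξ : X.G.PacketH) (h₁ : X.IsOneDimH ξ), ∃ r : GKIrrep (uFormGroup (Fin 2) (Fin 1)), GKIrrClass.mk r = a₀ ξ h₁ ∧ IsAdmissibleGK r.ρK ∧ r.IsInfUnitaryAlongP)
    (hR₁ : ∀ (P : X.G.Packet) (ξ : X.G.PacketH) (h₁ : X.IsOneDimH ξ), X.G.IsAPacket P → X.G.liftsTo ξ P →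
      ∀ φf (f : TG), (ArchTestKc L ι₀ H T hT φf.1 ∧ (∀ v, IsLocallyConstant (φf.2 v) ∧ HasCompactSupport (φf.2 v)) ∧ {v | φf.2 v ≠ (cmLocalIntegralLevel L 3 H v : Set ((cmDatum L 3 H).Local v)).indicator fun _ => (1 : ℂ)}.Finite) →
      Transfer φf f →
      X.G.packetTrace X.tr P f =
        (-1) ^ (gammaSph _ TG TH L ι₀ H T hT μA (xiPacketFamilyOfRecordSCD L H hH hHd μω hμu μZ keys hSC) 𝔩 X).N *
          (archTr₀ L ι₀ H T hT νinf (a₀ ξ h₁) φf.1 *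
            ∏ v ∈ (xiTruncOfRecordSCD L H hH hHd μω hμu μZ keys hSC μv (X.oneDimOf ξ h₁) φf.2) with ¬ p ξ h₁ v, (letI : MeasurableSpace ((cmDatum L 3 H).Local v) := borel _;
              (((xiPacketFamilyOfRecordSCD L H hH hHd μω hμu μZ keys hSC) (X.oneDimOf ξ h₁) v).πn).smoothTrace (μv v) (φf.2 v))) *
          ∏ i ∈ (xiTruncOfRecordSCD L H hH hHd μω hμu μZ keys hSC μv (X.oneDimOf ξ h₁) φf.2).subtype (p ξ h₁), (letI : MeasurableSpace ((cmDatum L 3 H).Local i) := borel _;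
            ((((xiPacketFamilyOfRecordSCD L H hH hHd μω hμu μZ keys hSC) (X.oneDimOf ξ h₁) (i : _)).πn).smoothTrace (μv i) (φf.2 i) -
              (((xiPacketFamilyOfRecordSCD L H hH hHd μω hμu μZ keys hSC) (X.oneDimOf ξ h₁) (i : _)).πs.getD ((xiPacketFamilyOfRecordSCD L H hH hHd μω hμu μZ keys hSC) (X.oneDimOf ξ h₁) (i : _)).πn).smoothTrace (μv i) (φf.2 i))))
    (hR₂ : ∀ (ξ : X.G.PacketH) (h₁ : X.IsOneDimH ξ), ∀ φf (fH : TH), (ArchTestKc L ι₀ H T hT φf.1 ∧ (∀ v, IsLocallyConstant (φf.2 v) ∧ HasCompactSupport (φf.2 v)) ∧ {v | φf.2 v ≠ (cmLocalIntegralLevel L 3 H v : Set ((cmDatum L 3 H).Local v)).indicator fun _ => (1 : ℂ)}.Finite) →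
      TransferH φf fH →
      X.trH ξ fH =
        (-1) ^ (gammaSph _ TG TH L ι₀ H T hT μA (xiPacketFamilyOfRecordSCD L H hH hHd μω hμu μZ keys hSC) 𝔩 X).N * (gammaSph _ TG TH L ι₀ H T hT μA (xiPacketFamilyOfRecordSCD L H hH hHd μω hμu μZ keys hSC) 𝔩 X).c *
          (archTr₀ L ι₀ H T hT νinf (a₀ ξ h₁) φf.1 *
            ∏ v ∈ (xiTruncOfRecordSCD L H hH hHd μω hμu μZ keys hSC μv (X.oneDimOf ξ h₁) φf.2) with ¬ p ξ h₁ v, (letI : MeasurableSpace ((cmDatum L 3 H).Local v) := borel _;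
              (((xiPacketFamilyOfRecordSCD L H hH hHd μω hμu μZ keys hSC) (X.oneDimOf ξ h₁) v).πn).smoothTrace (μv v) (φf.2 v))) *
          ∏ i ∈ (xiTruncOfRecordSCD L H hH hHd μω hμu μZ keys hSC μv (X.oneDimOf ξ h₁) φf.2).subtype (p ξ h₁), (letI : MeasurableSpace ((cmDatum L 3 H).Local i) := borel _;
            ((((xiPacketFamilyOfRecordSCD L H hH hHd μω hμu μZ keys hSC) (X.oneDimOf ξ h₁) (i : _)).πn).smoothTrace (μv i) (φf.2 i) +
              (((xiPacketFamilyOfRecordSCD L H hH hHd μω hμu μZ keys hSC) (X.oneDimOf ξ h₁) (i : _)).πs.getD ((xiPacketFamilyOfRecordSCD L H hH hHd μω hμu μZ keys hSC) (X.oneDimOf ξ h₁) (i : _)).πn).smoothTrace (μv i) (φf.2 i))))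
    -- the guarded level tuple (shared with `hmn_of_levels'`) and the packet laws
    {Λ : Type} (𝓕 : Λ → ((UnitaryGroup.arch (↥(maximalRealSubfield L)) L (IsCMField.complexConj L) 3 H → ℂ) ×
        (∀ v : HeightOneSpectrum (𝓞 ↥(maximalRealSubfield L)), (cmDatum L 3 H).Local v → ℂ)) → Prop)
    (hsum𝓕 : ∀ (l : Λ) (f' : (UnitaryGroup.arch (↥(maximalRealSubfield L)) L (IsCMField.complexConj L) 3 H → ℂ) ×
        (∀ v : HeightOneSpectrum (𝓞 ↥(maximalRealSubfield L)), (cmDatum L 3 H).Local v → ℂ)),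
      𝓕 l f' → Summable (fun π' : (InnerFormSec146.RepPrimeSph L ι₀ H T hT μA) => (InnerFormSec146.mPrimeSph L ι₀ H T hT μA π' : ℂ) * X.trPrime π' f'))
    {E : Λ → Type}
    (tR : ∀ l, (InnerFormSec146.RepPrimeSph L ι₀ H T hT μA) → Option (E l)) (tP : ∀ l, X.G.Packet → Option (E l))
    -- (CMP-cov) THE COVER, PARTNER-GUARDED (= ★ p863134 `hcover_gammaSph_of_partner` ∕ (δ6d) `hcover𝓣`'s guard, with the test guard and `Transfer` available as well)
    (hcoverP : ∀ (f' : (UnitaryGroup.arch (↥(maximalRealSubfield L)) L (IsCMField.complexConj L) 3 H → ℂ) ×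
        (∀ v : HeightOneSpectrum (𝓞 ↥(maximalRealSubfield L)), (cmDatum L 3 H).Local v → ℂ)) (f : TG) (P : X.G.Packet),
      (ArchTestKc L ι₀ H T hT f'.1 ∧ (∀ v, IsLocallyConstant (f'.2 v) ∧ HasCompactSupport (f'.2 v)) ∧
        {v | f'.2 v ≠ (cmLocalIntegralLevel L 3 H v : Set ((cmDatum L 3 H).Local v)).indicator fun _ => (1 : ℂ)}.Finite) →
      (∃ π' : (InnerFormSec146.RepPrimeSph L ι₀ H T hT μA), InnerFormSec146.mPrimeSph L ι₀ H T hT μA π' ≠ 0 ∧ InnerFormSec146.evpRep L H μA 𝔩 π'.1 (X.finOfG P)) →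
      Transfer f' f → ∃ (l : Λ) (e : E l), 𝓕 l f' ∧ tP l P = some e)
    -- (LF-cut) THE `tsum` LEVEL IDENTITIES ASKED AT A-PACKETS ONLY (`P` lifted from a one-dimensional `ξ`): payer ★ `eq1462LevelTsum_at_of_thm1461_of_separation'` with `|Π̂(P)| < ∞` from `lifts P = {ξ}`
    (hlevTA : ∀ (l : Λ) (f' : (UnitaryGroup.arch (↥(maximalRealSubfield L)) L (IsCMField.complexConj L) 3 H → ℂ) ×
        (∀ v : HeightOneSpectrum (𝓞 ↥(maximalRealSubfield L)), (cmDatum L 3 H).Local v → ℂ)) (f : TG) (fH : TH),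
      𝓕 l f' → Transfer f' f → TransferH f' fH →
      ∀ (P : X.G.Packet) (ξ : X.G.PacketH), X.G.IsAPacket P → X.IsOneDimH ξ → X.G.liftsTo ξ P → ∀ (e : E l), tP l P = some e →
        (∑' π' : tR l ⁻¹' {some e}, (InnerFormSec146.mPrimeSph L ι₀ H T hT μA (π' : InnerFormSec146.RepPrimeSph L ι₀ H T hT μA) : ℂ) * X.trPrime π' f') =
          X.G.n P * X.G.packetTrace X.tr P f + 1 / 2 * X.G.endoSum X.trH P fH)
    (hgerm : ∀ l (π' : (InnerFormSec146.RepPrimeSph L ι₀ H T hT μA)) (P : X.G.Packet) (e : E l), tP l P = some e → tR l π' = some e →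
      InnerFormSec146.evpRep L H μA 𝔩 π'.1 (X.finOfG P))
    (hrig : ∀ (l : Λ) (f' : (UnitaryGroup.arch (↥(maximalRealSubfield L)) L (IsCMField.complexConj L) 3 H → ℂ) ×
        (∀ v : HeightOneSpectrum (𝓞 ↥(maximalRealSubfield L)), (cmDatum L 3 H).Local v → ℂ)),
      𝓕 l f' → ∀ (π' : (InnerFormSec146.RepPrimeSph L ι₀ H T hT μA)) (P : X.G.Packet) (e : E l), tP l P = some e →
        InnerFormSec146.evpRep L H μA 𝔩 π'.1 (X.finOfG P) → (InnerFormSec146.mPrimeSph L ι₀ H T hT μA π' : ℂ) * X.trPrime π' f' ≠ 0 → tR l π' = some e)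
    (hlifts : ∀ (P : X.G.Packet) (ξ : X.G.PacketH), X.G.IsAPacket P → X.IsOneDimH ξ → X.G.liftsTo ξ P → X.G.lifts P = {ξ})
    (hn : ∀ (P : X.G.Packet) (ξ : X.G.PacketH), X.G.IsAPacket P → X.IsOneDimH ξ → X.G.liftsTo ξ P → X.G.n P = 1 / 2)
    (hnH : ∀ ξ : X.G.PacketH, X.IsOneDimH ξ → X.G.nH ξ = 1)
    (hex : ∀ φf, (ArchTestKc L ι₀ H T hT φf.1 ∧ (∀ v, IsLocallyConstant (φf.2 v) ∧ HasCompactSupport (φf.2 v)) ∧ {v | φf.2 v ≠ (cmLocalIntegralLevel L 3 H v : Set ((cmDatum L 3 H).Local v)).indicator fun _ => (1 : ℂ)}.Finite) →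
      ∃ (f : TG) (fH : TH), Transfer φf f ∧ TransferH φf fH) :
    InnerFormSec146.DSplit L H → ∀ (P : X.G.Packet) (ξ : X.G.PacketH) (h₁ : X.IsOneDimH ξ)
      (hS : ∀ v : InnerFormSec146.Place L, v ∈ InnerFormSec146.S0 L H → X.MnNeZero ξ v),
      X.G.IsAPacket P → X.G.liftsTo ξ P → ∀ π' : (InnerFormSec146.RepPrimeSph L ι₀ H T hT μA), InnerFormSec146.evpRep L H μA 𝔩 π'.1 (X.finOfG P) →
        InnerFormSec146.mPrimeSph L ι₀ H T hT μA π' ≠ 0 →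
          InnerFormSec146.memPrime L H μA (xiPacketFamilyOfRecordSCD L H hH hHd μω hμu μZ keys hSC) π'.1
            (InnerFormSec146.piXiPrime L H μA (xiPacketFamilyOfRecordSCD L H hH hHd μω hμu μZ keys hSC) (X.oneDimOf ξ h₁)) := by
  intro _ P ξ h₁ hS hA hl π' hevp hm
  exact hcoeffMem_gammaSph_recordSCD L ι₀ H T hT νinf μv hdef hν hμ
    (fun v => (cmLocalIntegralLevel L 3 H v : Set ((cmDatum L 3 H).Local v)).indicator fun _ => (1 : ℂ))
    (fun v => ⟨(IsLevel.indicator (isCompact_isOpen_cmLocalIntegralLevel L 3 H v).2 (isCompact_isOpen_cmLocalIntegralLevel L 3 H v).1).isLocallyConstant,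
      Literature.Topology.hasCompactSupport_indicator_of_isCompact (isCompact_isOpen_cmLocalIntegralLevel L 3 H v).1 _⟩)
    hH hHd μω hμu μZ keys hSC μA 𝔩 hanis hF1b hARCH (eventually_smoothTrace_indicator_eq_one_of_isSpherical L H μv hμ hμK1) X Transfer TransferH htrX h₁ hS
    (p ξ h₁) (a₀ ξ h₁) (ha₀ ξ h₁)
    (fun v => isUnitarizable_πn_recordSCD L H hH hHd μω hμu μZ keys hSC hμω (X.oneDimOf ξ h₁) v)
    (fun v hv => isUnitarizable_πs_getD_recordSCD_of_nonsplit L H hH hHd μω hμu μZ keys hSC (X.oneDimOf ξ h₁) v (hp ξ h₁ v hv))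
    (fun i => πs_getD_ne_πn_recordSCD_of_nonsplit L H hH hHd μω hμu μZ keys hSC (X.oneDimOf ξ h₁) i (hp ξ h₁ i i.2))
    (fun φf => xiTruncOfRecordSCD L H hH hHd μω hμu μZ keys hSC μv (X.oneDimOf ξ h₁) φf.2)
    (fun φf hφ v hv => smoothTrace_πn_eq_one_of_not_mem_xiTruncOfRecordSCD L H hH hHd μω hμu μZ keys hSC μv hμ hμK1 hquad (X.oneDimOf ξ h₁) φf.2 hφ.2.2 v hv)
    (fun φf hφ i hi => smoothTrace_πs_eq_zero_of_not_mem_xiTruncOfRecordSCD L H hH hHd μω hμu μZ keys hSC μv hμ hμK1 hquad (X.oneDimOf ξ h₁) φf.2 hφ.2.2 i (hp ξ h₁ i i.2) hi)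
    (hR₁ P ξ h₁ hA hl) (hR₂ ξ h₁)
    -- `h63` at THIS `P`: a level covering `(φ, P)` exists because `π′` is a partner of `P`
    (fun φf hφ f fH hf hfH => by
      obtain ⟨l, e, hF, hP⟩ := hcoverP φf f P hφ ⟨π', hm, hevp⟩ hf
      exact hasSum_eq1463_at_of_levelA (gammaSph _ TG TH L ι₀ H T hT μA (xiPacketFamilyOfRecordSCD L H hH hHd μω hμu μZ keys hSC) 𝔩 X)
        𝓕 hsum𝓕 tR tP hgerm hrig P ξ φf f fH hF hP (hlevTA l φf f fH hF hf hfH P ξ hA h₁ hl e hP)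
        (hn P ξ hA h₁ hl) (hlifts P ξ hA h₁ hl) (hnH ξ h₁))
    hex
    (F0P3XiPacketFamilyOfRecord.hexc_of_xiPinSphericalCofinite L μω hμu μZ keys hquad
      (F0P3XiPinSphericalCofiniteHolds.xiPinSphericalCofinite_holds L) (X.oneDimOf ξ h₁))
    π' hevp hm

end Record

end Summit.HodgeConjecture.HodgeConjecture.R90.S9

end
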